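import Mathlib
import Literature.Analysis.FluidPDE.SelfSimilarEulerProfile
import Literature.Analysis.FluidPDE.SwirlTransportProofs
import Literature.Analysis.FluidPDE.VorticityStretching
import Literature.Analysis.FunctionSpaces.SobolevDomain
import Summits.NavierStokesRegularity.NavierStokesRegularity.Theorems.EulerZoomLiouvillePowerGaugeEulerLiouvilleWeakAxisymAzimuthal

/-!
# Crux `EulerZoomLiouville.PowerGaugeEulerLiouville` (stmt-NavierStokesRegularity-19832), weak stratum, line `weak_axisym` (ns-idea-11 g9):
# X1a, PART (B1) TOOLS — calculus of the singular azimuthal tests, pointwise identities, integrability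

Width seat ns-ezl-w2 g6 under the LEAD ns-typeII-p2 g15.  First-order weak calculus, no class, no Euler beyond the weak vorticity equation.
Data: `V, η ∈ L²_loc(ℝ³)`, `G ∈ L²_loc` (the DiPerna–Lions gradient), `W = γy + V` (`selfSimilarTransport γ 0 V`), `k×y = (−y₁,y₀,0)` (`rotGen`),
(1) `G(y)(k×y) = k×V(y)` a.e., (Ω) `curlCLM (G y) = η(y)·(k×y)` a.e. (azimuthal vorticity, part (A)), and THE WEAK VORTICITY EQUATION
`∫ ⟪Ω, e⟫ Dφ[W] = ∫ φ ⟪(1−3γ)Ω − GΩ, e⟫` for all tests `φ` and `e ∈ ℝ³`.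
This file: the singular azimuthal tests `φᵢ = ψ·(k×y)ᵢ/ϱ²` for `ψ` supported off the axis (`isTestFunctionOn_azimuthalTest`, `fderiv_azimuthalTest`),
the two pointwise identities of the summed test (`sum_vort_mul_fderiv_azimuthalTest`, `sum_azimuthalTest_mul_source`), and the integrability
of the five products that occur (`integrable_vort_mul_fderiv_test`, `integrable_test_mul_source`, `integrable_eta_mul_fderiv_test`,
`integrable_eta_mul_test`, `integrable_test_mul_eta_mul_radial`).  The law itself is `…WeakAxisymCasimirOffAxis`.

WHAT THIS IS NOT: not NS, not E, not X1a itself — 19832 is OPEN. [folklore]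
-/

noncomputable section

set_option linter.dupNamespace false

open MeasureTheory Set Filter Topology Function TopologicalSpace Metric
open scoped ENNReal NNReal RealInnerProductSpace ContDiff

namespace Summit.NavierStokesRegularity.NavierStokesRegularity.Theorems.PowerGaugeEulerLiouville.WeakAxisym

open Literature.Analysis.FunctionSpaces Literature.Analysis.FluidPDE

/-! ### Calculus of the singular azimuthal tests `ψ·(k×y)ᵢ/ϱ²` -/

section Calculus

/-- `ϱ² = y₀² + y₁²` is smooth. [folklore] -/
theorem contDiff_cylRadSq : ContDiff ℝ ∞ (fun y : EuclideanSpace ℝ (Fin 3) => y 0 ^ 2 + y 1 ^ 2) :=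
  (((EuclideanSpace.proj (𝕜 := ℝ) (0 : Fin 3)).contDiff).pow 2).add
    (((EuclideanSpace.proj (𝕜 := ℝ) (1 : Fin 3)).contDiff).pow 2)

/-- `ϱ²` has derivative `w ↦ 2(y₀w₀ + y₁w₁)`. [folklore] -/
theorem hasFDerivAt_cylRadSq (y : EuclideanSpace ℝ (Fin 3)) :
    ∃ Q : EuclideanSpace ℝ (Fin 3) →L[ℝ] ℝ, HasFDerivAt (fun y : EuclideanSpace ℝ (Fin 3) => y 0 ^ 2 + y 1 ^ 2) Q y ∧
      ∀ w, Q w = 2 * (y 0 * w 0 + y 1 * w 1) := by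
  have h0 : HasFDerivAt (fun y : EuclideanSpace ℝ (Fin 3) => y 0) (EuclideanSpace.proj (𝕜 := ℝ) (0 : Fin 3)) y :=
    (EuclideanSpace.proj (𝕜 := ℝ) (0 : Fin 3)).hasFDerivAt
  have h1 : HasFDerivAt (fun y : EuclideanSpace ℝ (Fin 3) => y 1) (EuclideanSpace.proj (𝕜 := ℝ) (1 : Fin 3)) y :=
    (EuclideanSpace.proj (𝕜 := ℝ) (1 : Fin 3)).hasFDerivAt
  have h := (h0.mul h0).add (h1.mul h1)
  have h' : HasFDerivAt (fun y : EuclideanSpace ℝ (Fin 3) => y 0 ^ 2 + y 1 ^ 2)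
      (y 0 • EuclideanSpace.proj (𝕜 := ℝ) (0 : Fin 3) + y 0 • EuclideanSpace.proj (𝕜 := ℝ) (0 : Fin 3) +
        (y 1 • EuclideanSpace.proj (𝕜 := ℝ) (1 : Fin 3) + y 1 • EuclideanSpace.proj (𝕜 := ℝ) (1 : Fin 3))) y :=
    h.congr_of_eventuallyEq (Eventually.of_forall fun z => by simp only [sq, Pi.add_apply, Pi.mul_apply])
  refine ⟨_, h', fun w => ?_⟩
  simp only [add_apply, smul_apply, EuclideanSpace.coe_proj, smul_eq_mul]
  ring

/-- The components `y ↦ (k×y)ᵢ` are smooth (linear). [folklore] -/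
theorem contDiff_rotGen_apply (i : Fin 3) : ContDiff ℝ ∞ (fun y : EuclideanSpace ℝ (Fin 3) => rotGen y i) :=
  (EuclideanSpace.proj (𝕜 := ℝ) i).contDiff.comp rotGenL.contDiff

/-- `y ↦ (k×y)ᵢ` has derivative `w ↦ (k×w)ᵢ`. [folklore] -/
theorem hasFDerivAt_rotGen_apply (i : Fin 3) (y : EuclideanSpace ℝ (Fin 3)) :
    HasFDerivAt (fun y : EuclideanSpace ℝ (Fin 3) => rotGen y i) ((EuclideanSpace.proj (𝕜 := ℝ) i).comp rotGenL) y :=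
  (EuclideanSpace.proj (𝕜 := ℝ) i).hasFDerivAt.comp y (hasFDerivAt_rotGen y)

/-- The singular azimuthal test `φᵢ = ψ·(k×y)ᵢ/ϱ²` is a test function when `ψ` is one and is supported off the axis. [folklore] -/
theorem isTestFunctionOn_azimuthalTest {ψ : EuclideanSpace ℝ (Fin 3) → ℝ}
    (hψ : IsTestFunctionOn (⊤ : Opens (EuclideanSpace ℝ (Fin 3))) ψ) {δ : ℝ} (hδ : 0 < δ)
    (hoff : ∀ y ∈ tsupport ψ, δ ≤ y 0 ^ 2 + y 1 ^ 2) (i : Fin 3) :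
    IsTestFunctionOn (⊤ : Opens (EuclideanSpace ℝ (Fin 3)))
      (fun y => ψ y * ((y 0 ^ 2 + y 1 ^ 2)⁻¹ * rotGen y i)) := by
  refine ⟨?_, ?_, by simp⟩
  · refine contDiff_iff_contDiffAt.2 fun y => ?_
    by_cases hq : y 0 ^ 2 + y 1 ^ 2 = 0
    · -- on the axis `ψ` vanishes identically near `y`
      have hy : y ∉ tsupport ψ := fun h => by have := hoff y h; linarith
      have hev : (fun y => ψ y * ((y 0 ^ 2 + y 1 ^ 2)⁻¹ * rotGen y i)) =ᶠ[𝓝 y] fun _ => (0 : ℝ) := by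
        filter_upwards [notMem_tsupport_iff_eventuallyEq.1 hy] with z hz
        rw [hz, Pi.zero_apply, zero_mul]
      exact contDiffAt_const.congr_of_eventuallyEq hev
    · exact hψ.contDiff.contDiffAt.mul ((contDiff_cylRadSq.contDiffAt.inv hq).mul (contDiff_rotGen_apply i).contDiffAt)
  · refine HasCompactSupport.intro hψ.hasCompactSupport.isCompact fun y hy => ?_
    rw [image_eq_zero_of_notMem_tsupport hy, zero_mul]

/-- The derivative of the singular azimuthal test off the axis:
`Dφᵢ(y)[w] = Dψ(y)[w]·(k×y)ᵢ/ϱ² + ψ(y)·((k×w)ᵢ/ϱ² − (k×y)ᵢ·2(y₀w₀+y₁w₁)/ϱ⁴)`. [folklore] -/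
theorem fderiv_azimuthalTest {ψ : EuclideanSpace ℝ (Fin 3) → ℝ} {y : EuclideanSpace ℝ (Fin 3)}
    (hψ : DifferentiableAt ℝ ψ y) (hq : y 0 ^ 2 + y 1 ^ 2 ≠ 0) (i : Fin 3) (w : EuclideanSpace ℝ (Fin 3)) :
    fderiv ℝ (fun y => ψ y * ((y 0 ^ 2 + y 1 ^ 2)⁻¹ * rotGen y i)) y w =
      fderiv ℝ ψ y w * ((y 0 ^ 2 + y 1 ^ 2)⁻¹ * rotGen y i) +
        ψ y * ((y 0 ^ 2 + y 1 ^ 2)⁻¹ * rotGen w i -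
          rotGen y i * (2 * (y 0 * w 0 + y 1 * w 1)) / (y 0 ^ 2 + y 1 ^ 2) ^ 2) := by
  obtain ⟨Q, hQ, hQw⟩ := hasFDerivAt_cylRadSq y
  have hinv : HasFDerivAt (fun y : EuclideanSpace ℝ (Fin 3) => (y 0 ^ 2 + y 1 ^ 2)⁻¹)
      ((ContinuousLinearMap.toSpanSingleton ℝ (-((y 0 ^ 2 + y 1 ^ 2) ^ 2)⁻¹)).comp Q) y :=
    (hasFDerivAt_inv hq).comp y hQ
  have h : HasFDerivAt (fun y => ψ y * ((y 0 ^ 2 + y 1 ^ 2)⁻¹ * rotGen y i))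
      (ψ y • (((y 0 ^ 2 + y 1 ^ 2)⁻¹ • (EuclideanSpace.proj (𝕜 := ℝ) i).comp rotGenL +
        rotGen y i • (ContinuousLinearMap.toSpanSingleton ℝ (-((y 0 ^ 2 + y 1 ^ 2) ^ 2)⁻¹)).comp Q)) +
        ((y 0 ^ 2 + y 1 ^ 2)⁻¹ * rotGen y i) • fderiv ℝ ψ y) y :=
    hψ.hasFDerivAt.mul (hinv.mul (hasFDerivAt_rotGen_apply i y))
  rw [h.fderiv]
  simp only [add_apply, smul_apply, smul_eq_mul, ContinuousLinearMap.coe_comp,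
    Function.comp_apply, rotGenL_apply, EuclideanSpace.coe_proj, hQw, ContinuousLinearMap.toSpanSingleton_apply]
  field_simp
  ring

end Calculus

/-! ### Pointwise identities of the summed test -/

section Pointwise

/-- `Σᵢ Ωᵢ Dφᵢ[w] = η Dψ[w] − ψ η (y₀w₀+y₁w₁)/ϱ²` for `Ω = η·(k×y)`, off the axis. [folklore] -/
theorem sum_vort_mul_fderiv_azimuthalTest {ψ : EuclideanSpace ℝ (Fin 3) → ℝ} {y : EuclideanSpace ℝ (Fin 3)}
    (hψ : DifferentiableAt ℝ ψ y) (hq : y 0 ^ 2 + y 1 ^ 2 ≠ 0) {Ω : EuclideanSpace ℝ (Fin 3)} {η : ℝ}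
    (hΩ : Ω = η • rotGen y) (w : EuclideanSpace ℝ (Fin 3)) :
    ∑ i : Fin 3, ⟪Ω, EuclideanSpace.single i (1 : ℝ)⟫ *
        fderiv ℝ (fun y => ψ y * ((y 0 ^ 2 + y 1 ^ 2)⁻¹ * rotGen y i)) y w =
      η * fderiv ℝ ψ y w - ψ y * η * ((y 0 * w 0 + y 1 * w 1) / (y 0 ^ 2 + y 1 ^ 2)) := by
  simp only [Fin.sum_univ_three, fderiv_azimuthalTest hψ hq, hΩ, EuclideanSpace.inner_single_right, PiLp.smul_apply,
    smul_eq_mul, rotGen_apply_zero, rotGen_apply_one, rotGen_apply_two, conj_trivial, one_mul]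
  field_simp
  ring

/-- `Σᵢ φᵢ ⟪(1−3γ)Ω − GΩ, eᵢ⟫ = ψ((1−3γ)η − η(y₀V₀+y₁V₁)/ϱ²)` for `Ω = η·(k×y)`, `G(k×y) = k×V`, off the axis. [folklore] -/
theorem sum_azimuthalTest_mul_source {ψ : EuclideanSpace ℝ (Fin 3) → ℝ} {y : EuclideanSpace ℝ (Fin 3)}
    (hq : y 0 ^ 2 + y 1 ^ 2 ≠ 0) {L : EuclideanSpace ℝ (Fin 3) →L[ℝ] EuclideanSpace ℝ (Fin 3)}
    {v : EuclideanSpace ℝ (Fin 3)} {η γ : ℝ} (hΩ : curlCLM L = η • rotGen y) (h1 : L (rotGen y) = rotGen v) :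
    ∑ i : Fin 3, ψ y * ((y 0 ^ 2 + y 1 ^ 2)⁻¹ * rotGen y i) *
        ⟪(1 - 3 * γ) • curlCLM L - L (curlCLM L), EuclideanSpace.single i (1 : ℝ)⟫ =
      ψ y * ((1 - 3 * γ) * η - η * ((y 0 * v 0 + y 1 * v 1) / (y 0 ^ 2 + y 1 ^ 2))) := by
  rw [hΩ, map_smul, h1]
  simp only [Fin.sum_univ_three, EuclideanSpace.inner_single_right, PiLp.sub_apply, PiLp.smul_apply, smul_eq_mul,
    rotGen_apply_zero, rotGen_apply_one, rotGen_apply_two, conj_trivial, one_mul]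
  field_simp
  ring

end Pointwise

/-! ### Measurability and integrability bookkeeping -/

section Integrability

variable {γ : ℝ} {V : EuclideanSpace ℝ (Fin 3) → EuclideanSpace ℝ (Fin 3)}
  {G : EuclideanSpace ℝ (Fin 3) → EuclideanSpace ℝ (Fin 3) →L[ℝ] EuclideanSpace ℝ (Fin 3)} {η : EuclideanSpace ℝ (Fin 3) → ℝ}

/-- A function in `L²` of every ball about the origin is a.e.-strongly measurable (any codomain). [folklore] -/
theorem aestronglyMeasurable_of_memLp_ball' {F : Type*} [NormedAddCommGroup F] {f : EuclideanSpace ℝ (Fin 3) → F}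
    (h : ∀ r : ℝ, MemLp f 2 (volume.restrict (ball (0 : EuclideanSpace ℝ (Fin 3)) r))) : AEStronglyMeasurable f volume := by
  have hU : (⋃ n : ℕ, ball (0 : EuclideanSpace ℝ (Fin 3)) (n : ℝ)) = univ := iUnion_ball_nat 0
  have h' : AEStronglyMeasurable f (volume.restrict (⋃ n : ℕ, ball (0 : EuclideanSpace ℝ (Fin 3)) (n : ℝ))) :=
    (aestronglyMeasurable_iUnion_iff).2 fun n => (h n).aestronglyMeasurable
  rwa [hU, Measure.restrict_univ] at h'

/-- `y ↦ Dφ(y)[W(y)]` is a.e.-strongly measurable for `φ ∈ C¹` and `W` a.e.-strongly measurable. [folklore] -/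
theorem aestronglyMeasurable_fderiv_apply {φ : EuclideanSpace ℝ (Fin 3) → ℝ} (hφ : Continuous (fderiv ℝ φ))
    {W : EuclideanSpace ℝ (Fin 3) → EuclideanSpace ℝ (Fin 3)} (hW : AEStronglyMeasurable W volume) :
    AEStronglyMeasurable (fun y => fderiv ℝ φ y (W y)) volume :=
  Continuous.comp_aestronglyMeasurable₂
    (g := fun (L : EuclideanSpace ℝ (Fin 3) →L[ℝ] ℝ) (v : EuclideanSpace ℝ (Fin 3)) => L v)
    (isBoundedBilinearMap_apply (𝕜 := ℝ) (E := EuclideanSpace ℝ (Fin 3)) (F := ℝ)).continuous hφ.aestronglyMeasurable hW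

/-- The drift `W = γ(y − 0) + V` is in `L²` of every ball when `V` is. [folklore] -/
theorem memLp_selfSimilarTransport_ball (hV2 : ∀ r : ℝ, MemLp V 2 (volume.restrict (ball (0 : EuclideanSpace ℝ (Fin 3)) r)))
    (γ r : ℝ) : MemLp (selfSimilarTransport γ 0 V) 2 (volume.restrict (ball (0 : EuclideanSpace ℝ (Fin 3)) r)) := by
  haveI : IsFiniteMeasure ((volume : Measure (EuclideanSpace ℝ (Fin 3))).restrict (ball (0 : EuclideanSpace ℝ (Fin 3)) r)) :=
    isFiniteMeasure_restrict.2 measure_ball_lt_top.ne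
  have h1 : MemLp (fun y : EuclideanSpace ℝ (Fin 3) => γ • (y - 0)) 2
      (volume.restrict (ball (0 : EuclideanSpace ℝ (Fin 3)) r)) := by
    refine MemLp.of_bound ((continuous_id.sub continuous_const).const_smul γ).aestronglyMeasurable (‖γ‖ * |r|) ?_
    filter_upwards [ae_restrict_mem measurableSet_ball] with y hy
    rw [norm_smul, sub_zero]
    exact mul_le_mul_of_nonneg_left ((mem_ball_zero_iff.1 hy).le.trans (le_abs_self r)) (norm_nonneg _)
  exact h1.add (hV2 r)

/-- (I1) `⟪Ω, e⟫·Dφ[W]` is integrable for a test `φ`, `Ω = curlCLM ∘ G`, `G, W ∈ L²_loc`. [folklore] -/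
theorem integrable_vort_mul_fderiv_test (hG2 : ∀ r : ℝ, MemLp G 2 (volume.restrict (ball (0 : EuclideanSpace ℝ (Fin 3)) r)))
    {W : EuclideanSpace ℝ (Fin 3) → EuclideanSpace ℝ (Fin 3)}
    (hW2 : ∀ r : ℝ, MemLp W 2 (volume.restrict (ball (0 : EuclideanSpace ℝ (Fin 3)) r)))
    {φ : EuclideanSpace ℝ (Fin 3) → ℝ} (hφ : IsTestFunctionOn (⊤ : Opens (EuclideanSpace ℝ (Fin 3))) φ)
    (e : EuclideanSpace ℝ (Fin 3)) :
    Integrable (fun y => ⟪curlCLM (G y), e⟫ * fderiv ℝ φ y (W y)) volume := by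
  obtain ⟨R, hR⟩ := hφ.hasCompactSupport.isCompact.isBounded.subset_ball (0 : EuclideanSpace ℝ (Fin 3))
  have hDc : Continuous (fderiv ℝ φ) := hφ.contDiff.continuous_fderiv (by simp)
  have hDs : HasCompactSupport (fderiv ℝ φ) := hφ.hasCompactSupport.fderiv (𝕜 := ℝ)
  obtain ⟨C, hC⟩ := hDc.bounded_above_of_compact_support hDs
  have hC0 : 0 ≤ C := (norm_nonneg _).trans (hC 0)
  have hGm : AEStronglyMeasurable G volume := aestronglyMeasurable_of_memLp_ball' hG2
  have hWm : AEStronglyMeasurable W volume := aestronglyMeasurable_of_memLp_ball' hW2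
  have hdom : Integrable ((ball (0 : EuclideanSpace ℝ (Fin 3)) R).indicator
      fun y => ‖e‖ * ‖curlCLM‖ * C * (‖G y‖ * ‖W y‖)) volume := by
    refine IntegrableOn.integrable_indicator ?_ measurableSet_ball
    exact ((hG2 R).norm.integrable_mul (hW2 R).norm).const_mul _
  refine Integrable.mono' hdom
    (((curlCLM.continuous.comp_aestronglyMeasurable hGm).inner aestronglyMeasurable_const).mul
      (aestronglyMeasurable_fderiv_apply hDc hWm)) (ae_of_all _ fun y => ?_)
  by_cases hy : y ∈ ball (0 : EuclideanSpace ℝ (Fin 3)) R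
  · rw [indicator_of_mem hy, norm_mul]
    have h1 : ‖⟪curlCLM (G y), e⟫‖ ≤ ‖curlCLM‖ * ‖G y‖ * ‖e‖ :=
      (norm_inner_le_norm _ _).trans (mul_le_mul_of_nonneg_right (curlCLM.le_opNorm _) (norm_nonneg _))
    have h2 : ‖fderiv ℝ φ y (W y)‖ ≤ C * ‖W y‖ :=
      ((fderiv ℝ φ y).le_opNorm _).trans (mul_le_mul_of_nonneg_right (hC y) (norm_nonneg _))
    calc ‖⟪curlCLM (G y), e⟫‖ * ‖fderiv ℝ φ y (W y)‖ ≤ ‖curlCLM‖ * ‖G y‖ * ‖e‖ * (C * ‖W y‖) :=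
          mul_le_mul h1 h2 (norm_nonneg _) (by positivity)
      _ = ‖e‖ * ‖curlCLM‖ * C * (‖G y‖ * ‖W y‖) := by ring
  · have hy' : y ∉ tsupport (fderiv ℝ φ) := fun h => hy (hR (tsupport_fderiv_subset ℝ h))
    rw [indicator_of_notMem hy, image_eq_zero_of_notMem_tsupport hy', zero_apply, mul_zero, norm_zero]

/-- (I2) `φ·⟪(1−3γ)Ω − GΩ, e⟫` is integrable for a test `φ` and `G ∈ L²_loc`. [folklore] -/
theorem integrable_test_mul_source (hG2 : ∀ r : ℝ, MemLp G 2 (volume.restrict (ball (0 : EuclideanSpace ℝ (Fin 3)) r)))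
    {φ : EuclideanSpace ℝ (Fin 3) → ℝ} (hφ : IsTestFunctionOn (⊤ : Opens (EuclideanSpace ℝ (Fin 3))) φ)
    (γ : ℝ) (e : EuclideanSpace ℝ (Fin 3)) :
    Integrable (fun y => φ y * ⟪(1 - 3 * γ) • curlCLM (G y) - G y (curlCLM (G y)), e⟫) volume := by
  obtain ⟨R, hR⟩ := hφ.hasCompactSupport.isCompact.isBounded.subset_ball (0 : EuclideanSpace ℝ (Fin 3))
  have hφc : Continuous φ := hφ.contDiff.continuous
  obtain ⟨C, hC⟩ := hφc.bounded_above_of_compact_support hφ.hasCompactSupport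
  have hC0 : 0 ≤ C := (norm_nonneg _).trans (hC 0)
  have hGm : AEStronglyMeasurable G volume := aestronglyMeasurable_of_memLp_ball' hG2
  haveI : IsFiniteMeasure ((volume : Measure (EuclideanSpace ℝ (Fin 3))).restrict (ball (0 : EuclideanSpace ℝ (Fin 3)) R)) :=
    isFiniteMeasure_restrict.2 measure_ball_lt_top.ne
  have hΩm : AEStronglyMeasurable (fun y => curlCLM (G y)) volume := curlCLM.continuous.comp_aestronglyMeasurable hGm
  have hGΩm : AEStronglyMeasurable (fun y => G y (curlCLM (G y))) volume :=
    Continuous.comp_aestronglyMeasurable₂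
      (g := fun (L : EuclideanSpace ℝ (Fin 3) →L[ℝ] EuclideanSpace ℝ (Fin 3)) (v : EuclideanSpace ℝ (Fin 3)) => L v)
      (isBoundedBilinearMap_apply (𝕜 := ℝ) (E := EuclideanSpace ℝ (Fin 3)) (F := EuclideanSpace ℝ (Fin 3))).continuous hGm hΩm
  have hdom : Integrable ((ball (0 : EuclideanSpace ℝ (Fin 3)) R).indicator
      fun y => C * ‖e‖ * ‖curlCLM‖ * (‖1 - 3 * γ‖ * ‖G y‖ + ‖G y‖ ^ 2)) volume := by
    refine IntegrableOn.integrable_indicator ?_ measurableSet_ball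
    refine Integrable.const_mul (Integrable.add ?_ ?_) _
    · exact ((hG2 R).integrable one_le_two).norm.const_mul _
    · exact (hG2 R).integrable_norm_pow two_ne_zero
  have hmeas : AEStronglyMeasurable (fun y => φ y * ⟪(1 - 3 * γ) • curlCLM (G y) - G y (curlCLM (G y)), e⟫) volume :=
    hφc.aestronglyMeasurable.mul (((hΩm.const_smul (1 - 3 * γ)).sub hGΩm).inner aestronglyMeasurable_const)
  refine Integrable.mono' hdom hmeas (ae_of_all _ fun y => ?_)
  by_cases hy : y ∈ ball (0 : EuclideanSpace ℝ (Fin 3)) R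
  · rw [indicator_of_mem hy, norm_mul]
    have h1 : ‖⟪(1 - 3 * γ) • curlCLM (G y) - G y (curlCLM (G y)), e⟫‖ ≤
        (‖1 - 3 * γ‖ * (‖curlCLM‖ * ‖G y‖) + ‖G y‖ * (‖curlCLM‖ * ‖G y‖)) * ‖e‖ := by
      refine (norm_inner_le_norm _ _).trans (mul_le_mul_of_nonneg_right ?_ (norm_nonneg _))
      refine (norm_sub_le _ _).trans (add_le_add ?_ ?_)
      · rw [norm_smul]; exact mul_le_mul_of_nonneg_left (curlCLM.le_opNorm _) (norm_nonneg _)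
      · exact ((G y).le_opNorm _).trans (mul_le_mul_of_nonneg_left (curlCLM.le_opNorm _) (norm_nonneg _))
    calc ‖φ y‖ * ‖⟪(1 - 3 * γ) • curlCLM (G y) - G y (curlCLM (G y)), e⟫‖
        ≤ C * ((‖1 - 3 * γ‖ * (‖curlCLM‖ * ‖G y‖) + ‖G y‖ * (‖curlCLM‖ * ‖G y‖)) * ‖e‖) :=
          mul_le_mul (hC y) h1 (norm_nonneg _) hC0
      _ = C * ‖e‖ * ‖curlCLM‖ * (‖1 - 3 * γ‖ * ‖G y‖ + ‖G y‖ ^ 2) := by ring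
  · have hy' : y ∉ tsupport φ := fun h => hy (hR h)
    rw [indicator_of_notMem hy, image_eq_zero_of_notMem_tsupport hy', zero_mul, norm_zero]

/-- (I3) `η·Dψ[W]` is integrable for a test `ψ` and `η, W ∈ L²_loc`. [folklore] -/
theorem integrable_eta_mul_fderiv_test (hη2 : ∀ r : ℝ, MemLp η 2 (volume.restrict (ball (0 : EuclideanSpace ℝ (Fin 3)) r)))
    {W : EuclideanSpace ℝ (Fin 3) → EuclideanSpace ℝ (Fin 3)}
    (hW2 : ∀ r : ℝ, MemLp W 2 (volume.restrict (ball (0 : EuclideanSpace ℝ (Fin 3)) r)))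
    {ψ : EuclideanSpace ℝ (Fin 3) → ℝ} (hψ : IsTestFunctionOn (⊤ : Opens (EuclideanSpace ℝ (Fin 3))) ψ) :
    Integrable (fun y => η y * fderiv ℝ ψ y (W y)) volume := by
  obtain ⟨R, hR⟩ := hψ.hasCompactSupport.isCompact.isBounded.subset_ball (0 : EuclideanSpace ℝ (Fin 3))
  have hDc : Continuous (fderiv ℝ ψ) := hψ.contDiff.continuous_fderiv (by simp)
  have hDs : HasCompactSupport (fderiv ℝ ψ) := hψ.hasCompactSupport.fderiv (𝕜 := ℝ)
  obtain ⟨C, hC⟩ := hDc.bounded_above_of_compact_support hDs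
  have hC0 : 0 ≤ C := (norm_nonneg _).trans (hC 0)
  have hηm : AEStronglyMeasurable η volume := aestronglyMeasurable_of_memLp_ball' hη2
  have hWm : AEStronglyMeasurable W volume := aestronglyMeasurable_of_memLp_ball' hW2
  have hdom : Integrable ((ball (0 : EuclideanSpace ℝ (Fin 3)) R).indicator fun y => C * (‖η y‖ * ‖W y‖)) volume := by
    refine IntegrableOn.integrable_indicator ?_ measurableSet_ball
    exact ((hη2 R).norm.integrable_mul (hW2 R).norm).const_mul _
  refine Integrable.mono' hdom (hηm.mul (aestronglyMeasurable_fderiv_apply hDc hWm)) (ae_of_all _ fun y => ?_)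
  by_cases hy : y ∈ ball (0 : EuclideanSpace ℝ (Fin 3)) R
  · rw [indicator_of_mem hy, norm_mul]
    have h2 : ‖fderiv ℝ ψ y (W y)‖ ≤ C * ‖W y‖ :=
      ((fderiv ℝ ψ y).le_opNorm _).trans (mul_le_mul_of_nonneg_right (hC y) (norm_nonneg _))
    calc ‖η y‖ * ‖fderiv ℝ ψ y (W y)‖ ≤ ‖η y‖ * (C * ‖W y‖) := mul_le_mul_of_nonneg_left h2 (norm_nonneg _)
      _ = C * (‖η y‖ * ‖W y‖) := by ring
  · have hy' : y ∉ tsupport (fderiv ℝ ψ) := fun h => hy (hR (tsupport_fderiv_subset ℝ h))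
    rw [indicator_of_notMem hy, image_eq_zero_of_notMem_tsupport hy', zero_apply, mul_zero, norm_zero]

/-- (I4) `η·ψ` is integrable for a test `ψ` and `η ∈ L²_loc`. [folklore] -/
theorem integrable_eta_mul_test (hη2 : ∀ r : ℝ, MemLp η 2 (volume.restrict (ball (0 : EuclideanSpace ℝ (Fin 3)) r)))
    {ψ : EuclideanSpace ℝ (Fin 3) → ℝ} (hψ : IsTestFunctionOn (⊤ : Opens (EuclideanSpace ℝ (Fin 3))) ψ) :
    Integrable (fun y => η y * ψ y) volume := by
  have hηl : LocallyIntegrable η volume := by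
    refine (locallyIntegrable_iff).2 fun K hK => ?_
    obtain ⟨r, hr⟩ := hK.isBounded.subset_ball (0 : EuclideanSpace ℝ (Fin 3))
    haveI : IsFiniteMeasure ((volume : Measure (EuclideanSpace ℝ (Fin 3))).restrict (ball (0 : EuclideanSpace ℝ (Fin 3)) r)) :=
      isFiniteMeasure_restrict.2 measure_ball_lt_top.ne
    exact IntegrableOn.mono_set ((hη2 r).integrable one_le_two) hr
  exact hηl.integrable_smul_right_of_hasCompactSupport hψ.contDiff.continuous hψ.hasCompactSupport

/-- (I5) `ψ η (y₀V₀+y₁V₁)/ϱ²` is integrable for a test `ψ` supported off the axis and `η, V ∈ L²_loc`. [folklore] -/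
theorem integrable_test_mul_eta_mul_radial (hη2 : ∀ r : ℝ, MemLp η 2 (volume.restrict (ball (0 : EuclideanSpace ℝ (Fin 3)) r)))
    (hV2 : ∀ r : ℝ, MemLp V 2 (volume.restrict (ball (0 : EuclideanSpace ℝ (Fin 3)) r)))
    {ψ : EuclideanSpace ℝ (Fin 3) → ℝ} (hψ : IsTestFunctionOn (⊤ : Opens (EuclideanSpace ℝ (Fin 3))) ψ) {δ : ℝ} (hδ : 0 < δ)
    (hoff : ∀ y ∈ tsupport ψ, δ ≤ y 0 ^ 2 + y 1 ^ 2) :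
    Integrable (fun y => ψ y * η y * ((y 0 * V y 0 + y 1 * V y 1) / (y 0 ^ 2 + y 1 ^ 2))) volume := by
  obtain ⟨R₀, hR₀⟩ := hψ.hasCompactSupport.isCompact.isBounded.subset_ball (0 : EuclideanSpace ℝ (Fin 3))
  set R : ℝ := max R₀ 1 with hRdef
  have hR : tsupport ψ ⊆ ball (0 : EuclideanSpace ℝ (Fin 3)) R := hR₀.trans (ball_subset_ball (le_max_left _ _))
  have hR0 : 0 ≤ R := zero_le_one.trans (le_max_right _ _)
  have hψc : Continuous ψ := hψ.contDiff.continuous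
  obtain ⟨C, hC⟩ := hψc.bounded_above_of_compact_support hψ.hasCompactSupport
  have hC0 : 0 ≤ C := (norm_nonneg _).trans (hC 0)
  have hηm : AEStronglyMeasurable η volume := aestronglyMeasurable_of_memLp_ball' hη2
  have hVm : AEStronglyMeasurable V volume := aestronglyMeasurable_of_memLp_ball' hV2
  have hdom : Integrable ((ball (0 : EuclideanSpace ℝ (Fin 3)) R).indicator
      fun y => C * (2 * R / δ) * (‖η y‖ * ‖V y‖)) volume := by
    refine IntegrableOn.integrable_indicator ?_ measurableSet_ball
    exact ((hη2 R).norm.integrable_mul (hV2 R).norm).const_mul _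
  have hmeas : AEStronglyMeasurable (fun y => ψ y * η y * ((y 0 * V y 0 + y 1 * V y 1) / (y 0 ^ 2 + y 1 ^ 2))) volume := by
    have hc0 : Measurable fun y : EuclideanSpace ℝ (Fin 3) => y 0 := (EuclideanSpace.proj (𝕜 := ℝ) (0 : Fin 3)).measurable
    have hc1 : Measurable fun y : EuclideanSpace ℝ (Fin 3) => y 1 := (EuclideanSpace.proj (𝕜 := ℝ) (1 : Fin 3)).measurable
    have hV0 : AEMeasurable (fun y => V y 0) volume :=
      (EuclideanSpace.proj (𝕜 := ℝ) (0 : Fin 3)).measurable.comp_aemeasurable hVm.aemeasurable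
    have hV1 : AEMeasurable (fun y => V y 1) volume :=
      (EuclideanSpace.proj (𝕜 := ℝ) (1 : Fin 3)).measurable.comp_aemeasurable hVm.aemeasurable
    exact ((hψc.aemeasurable.mul hηm.aemeasurable).mul
      (((hc0.aemeasurable.mul hV0).add (hc1.aemeasurable.mul hV1)).div
        ((hc0.pow_const 2).add (hc1.pow_const 2)).aemeasurable)).aestronglyMeasurable
  refine Integrable.mono' hdom hmeas (ae_of_all _ fun y => ?_)
  by_cases hy : y ∈ tsupport ψ
  · have hyB : y ∈ ball (0 : EuclideanSpace ℝ (Fin 3)) R := hR hy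
    have hq : δ ≤ y 0 ^ 2 + y 1 ^ 2 := hoff y hy
    have hq0 : 0 < y 0 ^ 2 + y 1 ^ 2 := hδ.trans_le hq
    rw [indicator_of_mem hyB, norm_mul, norm_mul, norm_div, Real.norm_of_nonneg hq0.le]
    have hyR : ‖y‖ ≤ R := (mem_ball_zero_iff.1 hyB).le
    have h0 : ‖y 0‖ ≤ ‖y‖ := PiLp.norm_apply_le y 0
    have h1 : ‖y 1‖ ≤ ‖y‖ := PiLp.norm_apply_le y 1
    have hV0 : ‖V y 0‖ ≤ ‖V y‖ := PiLp.norm_apply_le (V y) 0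
    have hV1 : ‖V y 1‖ ≤ ‖V y‖ := PiLp.norm_apply_le (V y) 1
    have hnum : ‖y 0 * V y 0 + y 1 * V y 1‖ ≤ 2 * R * ‖V y‖ := by
      refine (norm_add_le _ _).trans ?_
      rw [norm_mul, norm_mul]
      nlinarith [norm_nonneg (y 0), norm_nonneg (y 1), norm_nonneg (V y 0), norm_nonneg (V y 1), norm_nonneg (V y),
        mul_le_mul h0 hV0 (norm_nonneg _) (norm_nonneg _), mul_le_mul h1 hV1 (norm_nonneg _) (norm_nonneg _)]
    have hfrac : ‖y 0 * V y 0 + y 1 * V y 1‖ / (y 0 ^ 2 + y 1 ^ 2) ≤ 2 * R / δ * ‖V y‖ := by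
      rw [div_le_iff₀ hq0]
      calc ‖y 0 * V y 0 + y 1 * V y 1‖ ≤ 2 * R * ‖V y‖ := hnum
        _ = 2 * R / δ * ‖V y‖ * δ := by field_simp
        _ ≤ 2 * R / δ * ‖V y‖ * (y 0 ^ 2 + y 1 ^ 2) := by gcongr
    calc ‖ψ y‖ * ‖η y‖ * (‖y 0 * V y 0 + y 1 * V y 1‖ / (y 0 ^ 2 + y 1 ^ 2))
        ≤ C * ‖η y‖ * (2 * R / δ * ‖V y‖) := by gcongr; exact hC y
      _ = C * (2 * R / δ) * (‖η y‖ * ‖V y‖) := by ring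
  · rw [image_eq_zero_of_notMem_tsupport hy, zero_mul, zero_mul, norm_zero]
    exact indicator_nonneg (fun z _ => by positivity) _

end Integrability

end Summit.NavierStokesRegularity.NavierStokesRegularity.Theorems.PowerGaugeEulerLiouville.WeakAxisym

end
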